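/-
Copyright (c) 2026. All rights reserved.
Released under Apache 2.0 license as described in the file LICENSE.
-/
import Literature.NumberTheory.Weil1964.AdelicThetaDiagonalKernel
import Literature.NumberTheory.Weil1964.DoublingDiagonalPolarisation
import Literature.NumberTheory.Weil1964.AdelicSchrodingerConj
import HarnessLib

/-!
# The diagonal-kernel identity for Li's `δ_F`, unconditionally: `(ω(r_F δ_F)(φ₁ ⊠ φ̄₂))(0) = ⟨φ₁, φ₂⟩`

Topic `NumberTheory/Weil1964`; namespace `Literature.NumberTheory.Weil1964`.  KERNEL MATHEMATICS ONLY.  Origin: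
`pub-hodgecm` SEAMS sprint, site S4-10, kernel items (a) + (b) joined: the diagonal-kernel identity of
`AdelicThetaDiagonalKernel.lean` (`omega_ratThetaLiftContι_apply_zero`, hypotheses `hT`, `hA₀`, `hW`) instantiated
at the explicit rational symplectic element `δ_F = deltaDiag F ι` of `DoublingDiagonalPolarisation.lean`
(`ratSpι_deltaDiag_param` discharges `hW` with `A₀ = fromBlocks 0 T₀ 1 0`, `isUnit_fromBlocks_zero_one`
discharges `hA₀`, and `hT` is `isUnit_det_doubledGram`), and the complex-conjugate Schwartz–Bruhat function
`φ̄₂ = piSchwartzBruhatConj F ι φ₂` of `AdelicSchrodingerConj.lean` inserted in the second slot: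
**`(ω(r_F δ_F)(φ₁ ⊠ φ̄₂))(0) = ∫_{𝔸^ι} φ₁ φ̄₂ dν = ⟨φ₁, φ₂⟩`** for every `T₀ ∈ GL_ι(F)` and the Tamagawa-normalised Haar
measure (`ν(D^ι) = 1`) — [Li1992, (13) pp. 181–182] with `c = 1` [HarrisKudlaSweet1996, (1.16) p. 952].
-/

set_option autoImplicit false

noncomputable section

open scoped Matrix ComplexConjugate Classical

namespace Literature.NumberTheory.Weil1964

open NumberField MeasureTheory MeasureTheory.Measure IsDedekindDomain
open Literature.NumberTheory.Automorphic Literature.RepresentationTheory.HeisenbergGroup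

section DeltaInstance

variable {F : Type} [Field F] [NumberField F] {ι : Type} [Fintype ι] [DecidableEq ι]

variable [MeasurableSpace (AdeleRing (𝓞 F) F)] [BorelSpace (AdeleRing (𝓞 F) F)]
  (ν : Measure (ι → (AdeleRing (𝓞 F) F))) [ν.IsAddHaarMeasure]

/-- **the diagonal-kernel identity for `γ = δ_F`, unconditionally**: `(ω(r_F δ_F) Ψ)(0) = ∫ Ψ(u,u) dν` for the
Tamagawa-normalised `ν`. [cite: Li1992, (13) pp. 181–182] -/
theorem omega_ratThetaLiftContι_deltaDiag_apply_zero (T₀ : Matrix ι ι F) (hT₀ : IsUnit T₀)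
    (hν : ν (piFundamentalDomain F ι) = 1) (Ψ : piSchwartzBruhat F (ι ⊕ ι)) :
    ((adelicMpCont.omega F (ι ⊕ ι) (doubledGram (T₀.map (algebraMap F (AdeleRing (𝓞 F) F)))) (ratThetaLiftContι
        F (ι ⊕ ι) (doubledGram (T₀.map (algebraMap F (AdeleRing (𝓞 F) F)))) (isUnit_det_doubledGram T₀ hT₀)
        (deltaDiag F ι)) Ψ :
        piSchwartzBruhat F (ι ⊕ ι)) : (ι ⊕ ι → (AdeleRing (𝓞 F) F)) → ℂ) 0 =
      ∫ u, (Ψ : (ι ⊕ ι → (AdeleRing (𝓞 F) F)) → ℂ) (Sum.elim u u) ∂ν :=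
  omega_ratThetaLiftContι_apply_zero ν T₀ hT₀ (isUnit_det_doubledGram T₀ hT₀) (Matrix.fromBlocks 0 T₀ 1 0)
    (isUnit_fromBlocks_zero_one T₀ ((Matrix.isUnit_iff_isUnit_det _).1 hT₀)) (deltaDiag F ι)
    (fun y => ratSpι_deltaDiag_param F ι T₀ (isUnit_det_doubledGram T₀ hT₀) y) hν Ψ

/-- the box form: `(ω(r_F δ_F)(φ₁ ⊠ φ₂))(0) = ∫ φ₁ φ₂ dν`. [cite: Li1992, (13) pp. 181–182] -/
theorem omega_ratThetaLiftContι_deltaDiag_tensorToSum_apply_zero (T₀ : Matrix ι ι F) (hT₀ : IsUnit T₀)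
    (hν : ν (piFundamentalDomain F ι) = 1) (φ₁ φ₂ : piSchwartzBruhat F ι) :
    ((adelicMpCont.omega F (ι ⊕ ι) (doubledGram (T₀.map (algebraMap F (AdeleRing (𝓞 F) F)))) (ratThetaLiftContι
        F (ι ⊕ ι) (doubledGram (T₀.map (algebraMap F (AdeleRing (𝓞 F) F)))) (isUnit_det_doubledGram T₀ hT₀)
        (deltaDiag F ι)) (tensorToSum F ι ι φ₁ φ₂) :
        piSchwartzBruhat F (ι ⊕ ι)) : (ι ⊕ ι → (AdeleRing (𝓞 F) F)) → ℂ) 0 =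
      ∫ u, (φ₁ : (ι → (AdeleRing (𝓞 F) F)) → ℂ) u * (φ₂ : (ι → (AdeleRing (𝓞 F) F)) → ℂ) u ∂ν :=
  omega_ratThetaLiftContι_tensorToSum_apply_zero ν T₀ hT₀ (isUnit_det_doubledGram T₀ hT₀)
    (Matrix.fromBlocks 0 T₀ 1 0) (isUnit_fromBlocks_zero_one T₀ ((Matrix.isUnit_iff_isUnit_det _).1 hT₀))
    (deltaDiag F ι) (fun y => ratSpι_deltaDiag_param F ι T₀ (isUnit_det_doubledGram T₀ hT₀) y) hν φ₁ φ₂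

/-- **Li's (13): `δ(φ₁ ⊗ φ̄₂)(0) = ⟨φ₁, φ₂⟩`** — the box form with the complex-conjugate function in the second slot:
`(ω(r_F δ_F)(φ₁ ⊠ φ̄₂))(0) = ∫ φ₁ · conj φ₂ dν`. [cite: Li1992, (13) pp. 181–182; HarrisKudlaSweet1996, (1.16) p. 952] -/
theorem omega_ratThetaLiftContι_deltaDiag_tensorToSum_conj_apply_zero (T₀ : Matrix ι ι F) (hT₀ : IsUnit T₀)
    (hν : ν (piFundamentalDomain F ι) = 1) (φ₁ φ₂ : piSchwartzBruhat F ι) :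
    ((adelicMpCont.omega F (ι ⊕ ι) (doubledGram (T₀.map (algebraMap F (AdeleRing (𝓞 F) F)))) (ratThetaLiftContι
        F (ι ⊕ ι) (doubledGram (T₀.map (algebraMap F (AdeleRing (𝓞 F) F)))) (isUnit_det_doubledGram T₀ hT₀)
        (deltaDiag F ι)) (tensorToSum F ι ι φ₁ (piSchwartzBruhatConj F ι φ₂)) :
        piSchwartzBruhat F (ι ⊕ ι)) : (ι ⊕ ι → (AdeleRing (𝓞 F) F)) → ℂ) 0 =
      ∫ u, (φ₁ : (ι → (AdeleRing (𝓞 F) F)) → ℂ) u * conj ((φ₂ : (ι → (AdeleRing (𝓞 F) F)) → ℂ) u) ∂ν := by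
  rw [omega_ratThetaLiftContι_deltaDiag_tensorToSum_apply_zero ν T₀ hT₀ hν]
  rfl

end DeltaInstance

end Literature.NumberTheory.Weil1964
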